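import Literature.Computability.MetaComplexity.MCSPUniversalInverterProofs
import Literature.Computability.MetaComplexity.MCSPUniversalInverterPatching
import Literature.Computability.MetaComplexity.MCSPBreaksGenerators
import Literature.Computability.MetaComplexity.MCSPTableFunction
import Literature.Computability.Cryptography.OracleAdversaryPrecomp
import Literature.Computability.Complexity.PairPlumbing
import HarnessLib

/-!
# `MCSP` as a universal inverter: reduction to relativised uniform HILL (proofs)

The capstone of the proof architecture of the named fact
`AllenderEtAl2006_MCSP_universalInverter : UniversalAvgInverter (Oracle.ofLanguage MCSP)`
(`MCSPUniversalInverter.lean`; Allender–Buhrman–Koucký–van Melkebeek–Ronneburger 2006, Thm. 45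
with §4.2). The printed proof of Thm. 45 (pp. 23–24 of the author version) has two halves:

1. the statistical test `L` breaks the (GGM-stretched) generator `G_y` built from `f_y`, by a
   uniform probabilistic oracle machine `M^L` — proved in the tree for the dense test
   `L = (MCSPSize ⌊√(2ⁿ)⌋)ᶜ ∈ P^{MCSP}` and EVERY polynomial-time generator family
   (`mcspTest_breaks_generators`, `MCSPBreaksGenerators.lean`), up to the construction of the
   polynomial-time string function computing the hybrid truth table (hypothesis `hTab` below);
2. "We then apply Theorem 44" — the relativised, uniform, every-length form of
   Håstad–Impagliazzo–Levin–Luby (ABK⁺06 Thm. 44: for every oracle `L`, PPT `M`, polynomial `p`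
   there are PPT `N`, polynomial `q` such that for ANY `n` and `y`, if `M^L` tells
   `(y, G^{HILL}_{f_y}(U))` from `(y, U)` with advantage `≥ 1/p(n)` then `N^L` inverts `f_y` at
   length `n` with probability `≥ 1/q(n)`) — NOT in the tree (hypothesis `hHILL` below, stated
   for the oracle `L` above, with the seed length `sl(n) ≥ n` of the HILL generator explicit and
   the length `n` passed in unary next to the parameter, i.e. printed Thm. 44 for the function
   `f'(⟨y, 1ⁿ⟩, x) = f(y, x)`).

`mcsp_universalInverter_of_hill_of_tables` proves the named fact from these two hypotheses, and
**`mcsp_universalInverter_of_hill`** from `hHILL` ALONE (the table functions exist: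
`exists_tableFunction`, `MCSPTableFunction.lean`),
through the layers already in the tree: the breaking machine (1.) feeds `hHILL`; the resulting
inverters, re-parametrised from `⟨y, 1ⁿ⟩` to `y` (`OracleAdversary.exists_ppt_outputPMF_precomp`),
work at every `n ≥ 1`, are patched at `n = 0` (`UniversalAvgInverter.of_eventually`,
`MCSPUniversalInverterPatching.lean`), and are transferred from the oracle `L ∈ P^{MCSP}`
(`compl_MCSPSize_sqrt_mem_PRel`) to `MCSP` (`mcsp_universalInverter_of_exists_PRel`,
`MCSPUniversalInverterProofs.lean`). Theorems only; no new definitions or named facts.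

## References

* E. Allender, H. Buhrman, M. Koucký, D. van Melkebeek, D. Ronneburger, *Power from random
  strings*, SIAM J. Comput. 35(6) (2006) [AllenderEtAl2006]: Thm. 44 ("[HILL99]"), Thm. 45 and
  its proof (pp. 23–24), §4.2 (p. 24).
* J. Håstad, R. Impagliazzo, L. A. Levin, M. Luby, *A pseudorandom generator from any one-way
  function*, SIAM J. Comput. 28 (1999) [HastadImpagliazzoLevinLuby1999], Thm. 1.1 (uniform
  version).
* E. Allender, B. Das, *Zero knowledge and circuit minimization*, Inform. and Comput. 256 (2017)
  [AllenderDas2017]: Thm. 1 and the remark following it.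
-/

namespace Literature.Computability.MetaComplexity

open _root_.Computability Complexity Complexity.Brick Cryptography Finset

/-- The unary numeral `1ⁿ` has length `n`. [folklore] -/
private theorem length_unaryEncodeNat_mcsp (n : ℕ) : (unaryEncodeNat n).length = n := by
  induction n with
  | zero => rfl
  | succ n ih => simp [unaryEncodeNat, ih]

/-- The uniform average only depends on the values at `n`-bit strings. [folklore] -/
private theorem uniformAvg_congr_len {n : ℕ} {f g : List Bool → ℝ}
    (h : ∀ x : List Bool, x.length = n → f x = g x) : uniformAvg n f = uniformAvg n g := by
  unfold uniformAvg
  congr 1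
  exact Finset.sum_congr rfl fun v _ => h _ (by simp)

open scoped Classical in
/-- **The `MCSP` universal-inverter fact from relativised uniform HILL and the table functions.**
Let `L = (MCSPSize ⌊√(2ⁿ)⌋)ᶜ` (the dense `MCSP` test, in `P^{MCSP}`). Assume

* `hHILL` — ABK⁺06 Thm. 44 ([HILL99], relativised to `L`, uniform, at every length) for functions
  with parameter `⟨y, 1ⁿ⟩`: for every `F ∈ FP` with length-preserving sections there are a
  generator family `Gen ∈ FP` (length-doubling sections, seed length `sl(n) ≥ n` at input length
  `n`) such that for every PPT oracle adversary `M` and positive polynomial `p` there are a PPT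
  oracle adversary `N` and a positive polynomial `q` with: for ANY `n` and `y`, if
  `Pr_{z ← U_{2 sl(n)}}[M^L(⟨⟨y,1ⁿ⟩, z⟩) = 1] − Pr_{s ← U_{sl(n)}}[M^L(⟨⟨y,1ⁿ⟩, Gen ⟨⟨y,1ⁿ⟩, s⟩⟩) = 1]
  ≥ 1/p(n)`, then `N^L` inverts the section of `⟨⟨y,1ⁿ⟩, x⟩ ↦ F ⟨y, x⟩` at length `n` with
  probability `≥ 1/q(n)`;
* `hTab` — for every length-doubling `G ∈ FP` and polynomial `D`, some `h ∈ FP` computes the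
  hybrid truth tables of the distinguisher trees of `G` at depth `4|bin D(ℓ)|` (the table
  specification of `mcspTest_breaks_generators`).

Then `AllenderEtAl2006_MCSP_universalInverter` holds: `MCSP` is a universal average-case
inverter oracle. [cite: AllenderEtAl2006, Thm. 44, Thm. 45 (proof, pp. 23–24) and §4.2]
[cite: AllenderDas2017, Thm. 1 and the remark following it] -/
theorem mcsp_universalInverter_of_hill_of_tables
    (hHILL : ∀ (F : List Bool → List Bool), F ∈ FP →
      (∀ y x : List Bool, (F (boolPair y x)).length = x.length) →
      ∃ (Gen : List Bool → List Bool) (sl : Polynomial ℕ), Gen ∈ FP ∧ (∀ n, n ≤ sl.eval n) ∧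
        (∀ y' s : List Bool, (Gen (boolPair y' s)).length = 2 * s.length) ∧
        ∀ (M : OracleAdversary Bool), M.IsPPT encodingBoolBool →
          ∀ p : Polynomial ℕ, (∀ n, 0 < p.eval n) →
            ∃ (N : OracleAdversary (List Bool)) (q : Polynomial ℕ),
              N.IsPPT (encodingList Bool) ∧ (∀ n, 0 < q.eval n) ∧
              ∀ (n : ℕ) (y : List Bool),
                (1 : ℝ) / ((p.eval n : ℕ) : ℝ) ≤
                  uniformAvg (2 * sl.eval n) (fun z =>
                    (M.outputPMF (Oracle.ofLanguage (MCSPSize fun n => Nat.sqrt (2 ^ n))ᶜ)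
                      (boolPair (boolPair y (unaryEncodeNat n)) z) (some true)).toReal) -
                  uniformAvg (sl.eval n) (fun s =>
                    (M.outputPMF (Oracle.ofLanguage (MCSPSize fun n => Nat.sqrt (2 ^ n))ᶜ)
                      (boolPair (boolPair y (unaryEncodeNat n))
                        (Gen (boolPair (boolPair y (unaryEncodeNat n)) s))) (some true)).toReal) →
                (1 : ℝ) / ((q.eval n : ℕ) : ℝ) ≤
                  oracleInvertProb (fun w => F (boolPair (fstF (fstF w)) (sndF w))) N
                    (Oracle.ofLanguage (MCSPSize fun n => Nat.sqrt (2 ^ n))ᶜ)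
                    (boolPair y (unaryEncodeNat n)) n)
    (hTab : ∀ (G : List Bool → List Bool), G ∈ FP →
      (∀ y s : List Bool, (G (boolPair y s)).length = 2 * s.length) → ∀ D : Polynomial ℕ,
      ∃ h : List Bool → List Bool, h ∈ FP ∧
        ∀ (ℓ : ℕ) (hℓ : 0 < ℓ) (y z ρ : List Bool), z.length = 2 * ℓ →
          4 * Nat.size (D.eval ℓ) + ℓ + 2 ^ (4 * Nat.size (D.eval ℓ) + 1) * ℓ ≤ ρ.length →
          h (boolPair (boolPair y z) ρ) =
            truthTable (distFun
              (fun (b : Bool) (s' : Fin ℓ → Bool) (j : Fin ℓ) =>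
                (G (boolPair y (List.ofFn s'))).getD (cond b (ℓ + j) j) false)
              (fun s' : Fin ℓ → Bool => s' ⟨0, hℓ⟩)
              ((fun j : Fin ℓ => ρ.getD (4 * Nat.size (D.eval ℓ) + j) false),
                fun (t : Fin (2 ^ (4 * Nat.size (D.eval ℓ)))) (b : Bool) (j : Fin ℓ) =>
                  ρ.getD (4 * Nat.size (D.eval ℓ) + ℓ + (2 * t + cond b 1 0) * ℓ + j) false)
              (boolFunEquivFin (4 * Nat.size (D.eval ℓ)) fun t => ρ.getD t false)
              (fun (b : Bool) (j : Fin ℓ) => z.getD (cond b (ℓ + j) j) false))) :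
    AllenderEtAl2006_MCSP_universalInverter := by
  classical
  refine mcsp_universalInverter_of_exists_PRel
    ⟨(MCSPSize fun n => Nat.sqrt (2 ^ n))ᶜ, compl_MCSPSize_sqrt_mem_PRel, ?_⟩
  refine UniversalAvgInverter.of_eventually fun F r hF hlen => ?_
  -- HILL for `F` (its generator and reduction are parametrised by `y' = ⟨y, 1ⁿ⟩`)
  obtain ⟨Gen, sl, hGen, hsl, hGen2, hred⟩ := hHILL F hF hlen
  -- the breaking machine for `Gen`, parameters `y' = ⟨y, 1ⁿ⟩` of length `≤ 2 r(ℓ) + 2 + ℓ`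
  obtain ⟨D, hD64, hB⟩ := mcspTest_breaks_generators hGen hGen2 (2 * r + 2 + Polynomial.X)
  obtain ⟨h, hhFP, hspec⟩ := hTab Gen hGen hGen2 D
  obtain ⟨M, hM, hgap⟩ := hB h hhFP hspec
  -- HILL's inverter for the advantage polynomial `p(n) = 32 D(sl(n))⁴`
  set p : Polynomial ℕ := 32 * (D.comp sl) ^ 4 with hp
  have hpn : ∀ n, p.eval n = 32 * (D.eval (sl.eval n)) ^ 4 := fun n => by
    simp [hp, Polynomial.eval_comp]
  have hppos : ∀ n, 0 < p.eval n := fun n => by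
    rw [hpn]
    have := hD64 (sl.eval n)
    positivity
  obtain ⟨N, q, hN, hq, hinv⟩ := hred M hM p hppos
  -- re-parametrise the inverter: on `⟨y, v⟩` run `N` on `⟨⟨y, 1^{|v|}⟩, v⟩`
  have hgeq : (fun w : List Bool =>
      boolPair (boolPair (fstF w) (unaryEncodeNat (sndF w).length)) (sndF w)) =
        fanoutFn (fanoutFn fstF (onesFn ∘ sndF)) sndF := by
    funext w
    simp [fanoutFn_apply, onesFn]
  have hgFP : (fun w : List Bool =>
      boolPair (boolPair (fstF w) (unaryEncodeNat (sndF w).length)) (sndF w)) ∈ FP := by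
    rw [hgeq]
    exact fanoutFn_mem_FP (fanoutFn_mem_FP fstF_mem_FP
      (comp_mem_FP (g := onesFn) (f := sndF) onesFn_mem_FP sndF_mem_FP)) sndF_mem_FP
  obtain ⟨N₁, hN₁, hN₁law⟩ := OracleAdversary.exists_ppt_outputPMF_precomp N hN hgFP
  refine ⟨N₁, q, 1, hN₁, hq, fun n y hn hy => ?_⟩
  -- the gap of `M` at `(n, y)`
  have hℓ : 0 < sl.eval n := lt_of_lt_of_le hn (hsl n)
  have hy' : (boolPair y (unaryEncodeNat n)).length ≤
      (2 * r + 2 + Polynomial.X).eval (sl.eval n) := by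
    rw [length_boolPair, length_unaryEncodeNat_mcsp]
    have h1 := TM2Iter.eval_mono r (hsl n)
    have h2 := hsl n
    simp only [Polynomial.eval_add, Polynomial.eval_mul, Polynomial.eval_ofNat,
      Polynomial.eval_X]
    omega
  have hg := hgap (sl.eval n) hℓ (boolPair y (unaryEncodeNat n)) hy'
  have hpR : (1 : ℝ) / ((p.eval n : ℕ) : ℝ) = 1 / (32 * ((D.eval (sl.eval n) : ℕ) : ℝ) ^ 4) := by
    rw [hpn]; push_cast; rfl
  have hinv' := hinv n y (by rw [hpR]; exact hg)
  refine hinv'.trans (le_of_eq ?_)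
  -- the two inverters have the same success probability
  unfold oracleInvertProb
  refine uniformAvg_congr_len fun x hx => ?_
  unfold oracleInvertProbAt
  rw [hN₁law]
  have hFx : (F (boolPair y x)).length = n := by rw [hlen, hx]
  simp [hFx]

/-- **The `MCSP` universal-inverter fact from relativised uniform HILL alone** (ABK⁺06 Thm. 45
with §4.2 ⇐ ABK⁺06 Thm. 44 for the dense `MCSP` test): the table functions of
`mcsp_universalInverter_of_hill_of_tables` exist (`exists_tableFunction`). What remains open in
the tree is exactly the hypothesis `hHILL` — the relativised, uniform, every-length
Håstad–Impagliazzo–Levin–Luby theorem (ABK⁺06 Thm. 44, "[HILL99]").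
[cite: AllenderEtAl2006, Thm. 44, Thm. 45 (proof, pp. 23–24) and §4.2]
[cite: HastadImpagliazzoLevinLuby1999, Thm. 1.1] -/
theorem mcsp_universalInverter_of_hill
    (hHILL : ∀ (F : List Bool → List Bool), F ∈ FP →
      (∀ y x : List Bool, (F (boolPair y x)).length = x.length) →
      ∃ (Gen : List Bool → List Bool) (sl : Polynomial ℕ), Gen ∈ FP ∧ (∀ n, n ≤ sl.eval n) ∧
        (∀ y' s : List Bool, (Gen (boolPair y' s)).length = 2 * s.length) ∧
        ∀ (M : OracleAdversary Bool), M.IsPPT encodingBoolBool →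
          ∀ p : Polynomial ℕ, (∀ n, 0 < p.eval n) →
            ∃ (N : OracleAdversary (List Bool)) (q : Polynomial ℕ),
              N.IsPPT (encodingList Bool) ∧ (∀ n, 0 < q.eval n) ∧
              ∀ (n : ℕ) (y : List Bool),
                (1 : ℝ) / ((p.eval n : ℕ) : ℝ) ≤
                  uniformAvg (2 * sl.eval n) (fun z =>
                    (M.outputPMF (Oracle.ofLanguage (MCSPSize fun n => Nat.sqrt (2 ^ n))ᶜ)
                      (boolPair (boolPair y (unaryEncodeNat n)) z) (some true)).toReal) -
                  uniformAvg (sl.eval n) (fun s =>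
                    (M.outputPMF (Oracle.ofLanguage (MCSPSize fun n => Nat.sqrt (2 ^ n))ᶜ)
                      (boolPair (boolPair y (unaryEncodeNat n))
                        (Gen (boolPair (boolPair y (unaryEncodeNat n)) s))) (some true)).toReal) →
                (1 : ℝ) / ((q.eval n : ℕ) : ℝ) ≤
                  oracleInvertProb (fun w => F (boolPair (fstF (fstF w)) (sndF w))) N
                    (Oracle.ofLanguage (MCSPSize fun n => Nat.sqrt (2 ^ n))ᶜ)
                    (boolPair y (unaryEncodeNat n)) n) :
    AllenderEtAl2006_MCSP_universalInverter :=
  mcsp_universalInverter_of_hill_of_tables hHILL fun _ hG hG2 D => exists_tableFunction hG hG2 D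

end Literature.Computability.MetaComplexity
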